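import Summits.Parity.BatemanHorn.Theorems.AlmostPrimeZerosSystemLSDRealSegmentLocalMult
import Literature.NumberTheory.LFunctions.HallTenenbaumTheorem01
import Literature.NumberTheory.LFunctions.MertensElementary
import HarnessLib

/-!
# Route `AlmostPrimeZeros`, crux `SystemLSDRealSegment` (stmt-Parity-11292), line
# `beta-thinned-root-kernel`: the kernel law for LINEAR systems (calibration of `stub_betaKernel`)

For a Bateman–Horn system `f : Fin 1 → ℤ[X]` with `deg f₀ = 1` (`f₀ = aX + b`, `a ≥ 1`) and every real
`y > 1` we prove the beyond-level kernel law `BetaKernelLaw 1 f y` of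
`Summits/Parity/BatemanHorn/Theorems/AlmostPrimeZerosDefs.lean`.  Here `D = deg f₀ = 1`, so the forced
constant `λ_f(y)(D^{y−1}Γ(y)^{−1} − Γ(y)^{−1})` VANISHES and the claim is `K_x(y) = o(x (log x)^{y−1})`,
`K_x(y) = Σ_{n ≤ x} Σ_{d ∣ f₀(n), d > x} h_y(d)`.

* `kernelSum_le_of_natDegree_eq_one` — a divisor `d > x` of the value `N = f₀(n) ≤ E(x+1)`
  (`E = |a| + |b| + 1`) has cofactor `N/d ≤ E`, and `(n, d) ↦ (N/d, d)` is injective, so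
  `K_x(y) ≤ E · Σ_{m ≤ E(x+1)} h_y(m)`;
* `sum_thinWeight_le` — the MEAN VALUE `Σ_{m ≤ X} h_y(m) ≤ C (X / log X) (log X)^{y−1}`: Hall–Tenenbaum
  Theorem 01 (`HallTenenbaum.theorem01`, hypotheses (0.5)–(0.6) from Chebyshev through `h_y(p^ν) ≤ y²`)
  and (0.4) (`HallTenenbaum.sum_div_le_prod_tsum`), the local factor `1 + (y−1)/p + (y²−y)/p²` being
  `≤ exp((y−1)/p + y²/(p(p−1)))`, and Mertens II upper half `Σ_{p ≤ X} 1/p ≤ log log X + 4`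
  (`MertensBound.sum_inv_prime_le`);
* `betaKernelLaw_of_natDegree_eq_one` (registered) — hence `x⁻¹ (log x)^{1−y} K_x(y) ≪ 1/log x → 0`.

References: R. R. Hall, G. Tenenbaum, *Divisors* (1988) Theorem 01 and (0.4); the line card
`Cruxes/SystemLSDRealSegment/Lines/beta-thinned-root-kernel.md`.
-/

open Filter Finset Polynomial
open scoped BigOperators Topology

namespace Summit.Parity.BatemanHorn.Cruxes.SystemLSDRealSegment.BetaThinnedRootKernel

open Literature.NumberTheory.Sieve
open Literature.NumberTheory.LFunctions

noncomputable section

/-! ### Hall–Tenenbaum hypotheses for the thinned weight -/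

/-- `h_y(p^ν) ≤ y²` for `y ≥ 1`. [folklore] -/
theorem thinWeight_prime_pow_le_sq {y : ℝ} (hy : 1 ≤ y) {p : ℕ} (hp : p.Prime) (ν : ℕ) :
    thinWeight y (p ^ ν) ≤ y ^ 2 := by
  rw [thinWeight_prime_pow y hp]
  exact thinCoeff_le_sq hy ν

/-- Hypothesis (0.5) for `h_y`: `Σ_{p ≤ Y} h_y(p) log p ≤ (y² log 4) Y` (Chebyshev, through `h_y/y² ≤ 1` at
primes). [folklore] -/
theorem thinWeight_hypA {y : ℝ} (hy : 1 ≤ y) {Y : ℝ} (hY : 0 ≤ Y) :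
    ∑ p ∈ Nat.primesLE ⌊Y⌋₊, thinWeight y p * Real.log p ≤ y ^ 2 * Real.log 4 * Y := by
  have hy2 : 0 < y ^ 2 := by positivity
  have hg1 : ∀ n, (fun n => min (thinWeight y n / y ^ 2) 1) n ≤ 1 := fun n => min_le_right _ _
  have hgp : ∀ p ∈ Nat.primesLE ⌊Y⌋₊, thinWeight y p * Real.log p =
      y ^ 2 * ((fun n => min (thinWeight y n / y ^ 2) 1) p * Real.log p) := by
    intro p hp
    have hp' := Nat.prime_of_mem_primesLE hp
    have hle : thinWeight y p / y ^ 2 ≤ 1 := by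
      rw [div_le_one hy2]
      simpa using thinWeight_prime_pow_le_sq hy hp' 1
    simp only [min_eq_left hle]
    field_simp
  rw [Finset.sum_congr rfl hgp, ← Finset.mul_sum]
  calc y ^ 2 * ∑ p ∈ Nat.primesLE ⌊Y⌋₊, (fun n => min (thinWeight y n / y ^ 2) 1) p * Real.log p
      ≤ y ^ 2 * (Real.log 4 * Y) := mul_le_mul_of_nonneg_left (HallTenenbaum.hypA_of_le_one hg1 hY) hy2.le
    _ = y ^ 2 * Real.log 4 * Y := by ring

/-- Hypothesis (0.6) for `h_y`: `Σ_{p ≤ Y} Σ_{2 ≤ ν ≤ Y} h_y(p^ν) log(p^ν)/p^ν ≤ y² B₁`. [folklore] -/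
theorem thinWeight_hypB {y : ℝ} (hy : 1 ≤ y) (Y : ℕ) :
    ∑ p ∈ Nat.primesLE Y, ∑ ν ∈ Icc 2 Y, thinWeight y (p ^ ν) / p ^ ν * Real.log (p ^ ν) ≤
      y ^ 2 * HallTenenbaum.B₁ := by
  have hy2 : 0 < y ^ 2 := by positivity
  have hg1 : ∀ n, (fun n => min (thinWeight y n / y ^ 2) 1) n ≤ 1 := fun n => min_le_right _ _
  have hgp : ∀ p ∈ Nat.primesLE Y, ∑ ν ∈ Icc 2 Y, thinWeight y (p ^ ν) / p ^ ν * Real.log (p ^ ν) =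
      y ^ 2 * ∑ ν ∈ Icc 2 Y,
        (fun n => min (thinWeight y n / y ^ 2) 1) (p ^ ν) / p ^ ν * Real.log (p ^ ν) := by
    intro p hp
    have hp' := Nat.prime_of_mem_primesLE hp
    rw [Finset.mul_sum]
    refine Finset.sum_congr rfl fun ν _ => ?_
    have hle : thinWeight y (p ^ ν) / y ^ 2 ≤ 1 := by
      rw [div_le_one hy2]
      exact thinWeight_prime_pow_le_sq hy hp' ν
    simp only [min_eq_left hle]
    field_simp
  rw [Finset.sum_congr rfl hgp, ← Finset.mul_sum]
  exact mul_le_mul_of_nonneg_left (HallTenenbaum.hypB_of_le_one hg1 Y) hy2.le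

/-- The local factor of `h_y` at `p`: `Σ_ν h_y(p^ν)/p^ν = 1 + (y−1)/p + (y²−y)/p² ≤ exp((y−1)/p + y²/(p(p−1)))`,
and the series is (finitely supported, hence) summable. [folklore] -/
theorem tsum_thinWeight_div_le {y : ℝ} (hy : 1 ≤ y) {p : ℕ} (hp : p.Prime) :
    Summable (fun ν : ℕ => thinWeight y (p ^ ν) / (p : ℝ) ^ ν) ∧
      ∑' ν : ℕ, thinWeight y (p ^ ν) / (p : ℝ) ^ ν ≤
        Real.exp ((y - 1) * (1 / p) + y ^ 2 * (1 / ((p : ℝ) * (p - 1)))) := by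
  have hzero : ∀ ν ∉ range 3, thinWeight y (p ^ ν) / (p : ℝ) ^ ν = 0 := by
    intro ν hν
    rw [Finset.mem_range, not_lt] at hν
    rw [thinWeight_prime_pow y hp, thinCoeff_of_three_le y hν, zero_div]
  refine ⟨summable_of_ne_finset_zero hzero, ?_⟩
  rw [tsum_eq_sum hzero]
  have hp2 : (2 : ℝ) ≤ p := by exact_mod_cast hp.two_le
  have hp0 : (0 : ℝ) < p := by linarith
  have hy2 : 0 ≤ y ^ 2 := by positivity
  rw [Finset.sum_range_succ, Finset.sum_range_succ, Finset.sum_range_one, pow_zero, pow_zero, pow_one,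
    pow_one, thinWeight_one, thinWeight_prime y hp, thinWeight_prime_pow y hp 2, thinCoeff_two, div_one]
  refine le_trans ?_ (Real.add_one_le_exp _)
  have h1 : (1 : ℝ) / (p : ℝ) ^ 2 ≤ 1 / ((p : ℝ) * (p - 1)) :=
    one_div_le_one_div_of_le (by nlinarith) (by nlinarith)
  have h2 : (y ^ 2 - y) / (p : ℝ) ^ 2 ≤ y ^ 2 * (1 / ((p : ℝ) * (p - 1))) := by
    calc (y ^ 2 - y) / (p : ℝ) ^ 2 ≤ y ^ 2 / (p : ℝ) ^ 2 :=
          div_le_div_of_nonneg_right (by linarith) (by positivity)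
      _ = y ^ 2 * (1 / (p : ℝ) ^ 2) := by ring
      _ ≤ y ^ 2 * (1 / ((p : ℝ) * (p - 1))) := mul_le_mul_of_nonneg_left h1 hy2
  have h3 : (y - 1) / (p : ℝ) = (y - 1) * (1 / p) := by ring
  linarith

/-! ### The mean value of the thinned weight -/

/-- **Mean value of `h_y`** (`y > 1`): `Σ_{m ≤ X} h_y(m) ≤ C · (X / log X) · (log X)^{y−1}` for all `X ≥ 2`
— Hall–Tenenbaum Theorem 01 with (0.4), the local factors `≤ exp((y−1)/p + y²/(p(p−1)))`, and the upper
half of Mertens' second theorem. [cite: HallTenenbaum1988, Theorem 01 and (0.4)] -/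
theorem sum_thinWeight_le {y : ℝ} (hy : 1 < y) :
    ∃ C : ℝ, 0 < C ∧ ∀ X : ℕ, 2 ≤ X → ∑ m ∈ Icc 1 X, thinWeight y m ≤
      C * ((X : ℝ) / Real.log X) * Real.exp ((y - 1) * Real.log (Real.log X)) := by
  have hy1 : 1 ≤ y := hy.le
  have hy2 : 0 < y ^ 2 := by positivity
  have hf1 : thinWeight y 1 = 1 := thinWeight_one y
  have hmul : ∀ m n : ℕ, Nat.Coprime m n → thinWeight y (m * n) = thinWeight y m * thinWeight y n :=
    fun m n hmn => thinWeight_mul_of_coprime y hmn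
  have hf0 : ∀ n, 0 ≤ thinWeight y n := thinWeight_nonneg hy1
  have hB₁ := HallTenenbaum.B₁_nonneg
  have hl4 : 0 ≤ Real.log 4 := Real.log_nonneg (by norm_num)
  refine ⟨(y ^ 2 * Real.log 4 + y ^ 2 * HallTenenbaum.B₁ + 1) * Real.exp (4 * (y - 1) + y ^ 2),
    by positivity, fun X hX => ?_⟩
  have hX1 : (1 : ℝ) < X := by exact_mod_cast hX
  have h01 := HallTenenbaum.theorem01 hf1 hmul hf0 (fun Y hY => thinWeight_hypA hy1 hY)
    (thinWeight_hypB hy1) hX1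
  rw [Nat.floor_natCast] at h01
  have hM : ∑ n ∈ Icc 1 X, thinWeight y n / n ≤
      Real.exp (4 * (y - 1) + y ^ 2) * Real.exp ((y - 1) * Real.log (Real.log X)) := by
    refine (HallTenenbaum.sum_div_le_prod_tsum hf1 hmul hf0
      (fun p hp => (tsum_thinWeight_div_le hy1 hp).1) X).trans ?_
    calc ∏ p ∈ Nat.primesLE X, ∑' ν : ℕ, thinWeight y (p ^ ν) / (p : ℝ) ^ ν
        ≤ ∏ p ∈ Nat.primesLE X, Real.exp ((y - 1) * (1 / p) + y ^ 2 * (1 / ((p : ℝ) * (p - 1)))) :=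
          Finset.prod_le_prod (fun p _ => tsum_nonneg fun ν => div_nonneg (hf0 _) (by positivity))
            fun p hp => (tsum_thinWeight_div_le hy1 (Nat.prime_of_mem_primesLE hp)).2
      _ = Real.exp ((y - 1) * ∑ p ∈ Nat.primesLE X, (1 : ℝ) / p +
            y ^ 2 * ∑ p ∈ Nat.primesLE X, 1 / ((p : ℝ) * (p - 1))) := by
          rw [← Real.exp_sum, Finset.sum_add_distrib, Finset.mul_sum, Finset.mul_sum]
      _ ≤ Real.exp ((y - 1) * (Real.log (Real.log X) + 4) + y ^ 2 * 1) := by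
          rw [Real.exp_le_exp]
          have h1 := MertensBound.sum_inv_prime_le X hX
          have h2 := HallTenenbaum.sum_primesLE_inv_mul_pred_le_one X
          have hy0 : 0 ≤ y - 1 := by linarith
          nlinarith [mul_le_mul_of_nonneg_left h1 hy0, mul_le_mul_of_nonneg_left h2 hy2.le]
      _ = Real.exp (4 * (y - 1) + y ^ 2) * Real.exp ((y - 1) * Real.log (Real.log X)) := by
          rw [← Real.exp_add]; ring_nf
  have hc : 0 ≤ (y ^ 2 * Real.log 4 + y ^ 2 * HallTenenbaum.B₁ + 1) * ((X : ℝ) / Real.log X) := by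
    have : 0 ≤ (X : ℝ) / Real.log X := div_nonneg (by positivity) (Real.log_nonneg hX1.le)
    positivity
  calc ∑ m ∈ Icc 1 X, thinWeight y m ≤ _ := h01
    _ ≤ (y ^ 2 * Real.log 4 + y ^ 2 * HallTenenbaum.B₁ + 1) * ((X : ℝ) / Real.log X) *
          (Real.exp (4 * (y - 1) + y ^ 2) * Real.exp ((y - 1) * Real.log (Real.log X))) :=
        mul_le_mul_of_nonneg_left hM hc
    _ = _ := by ring

/-! ### The kernel of a linear system is dominated by the mean value -/

/-- **Kernel domination for a linear system.**  If `deg f₀ = 1`, `f₀ = aX + b`, put `E = |a| + |b| + 1`; for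
`1 ≤ x`: `K_x(y) ≤ E · Σ_{1 ≤ m ≤ E(x+1)} h_y(m)` (`y ≥ 1`).  A divisor `d > x` of the normalised value
`N = max(f₀(n), 1) ≤ E(x+1)` has cofactor `N/d ≤ E`, and `(n, d) ↦ (N/d, d)` is injective on the index set of
`K_x` (it recovers `N = f₀(n) ≥ 2`, hence `n`). [folklore] -/
theorem kernelSum_le_of_natDegree_eq_one (f : Fin 1 → ℤ[X]) (hdeg : (f 0).natDegree = 1) {y : ℝ}
    (hy : 1 ≤ y) :
    ∃ E : ℕ, 1 ≤ E ∧ ∀ x : ℕ, 1 ≤ x →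
      kernelSum f y x ≤ (E : ℝ) * ∑ m ∈ Icc 1 (E * (x + 1)), thinWeight y m := by
  classical
  set a : ℤ := (f 0).coeff 1 with ha_def
  set b : ℤ := (f 0).coeff 0 with hb_def
  have ha : a ≠ 0 := by
    have h : (f 0).leadingCoeff = a := by rw [Polynomial.leadingCoeff, hdeg]
    rw [← h, Ne, Polynomial.leadingCoeff_eq_zero]
    intro h0
    rw [h0, Polynomial.natDegree_zero] at hdeg
    exact zero_ne_one hdeg
  have hev : ∀ n : ℕ, (f 0).eval (n : ℤ) = a * n + b := by
    intro n
    conv_lhs => rw [Polynomial.eq_X_add_C_of_natDegree_le_one hdeg.le]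
    simp [ha_def, hb_def]
  -- the normalised value `N n = max (f₀(n))⁺ 1`, so that `divSet (f₀(n)).toNat = (N n).divisors`
  set N : ℕ → ℕ := fun n => max ((f 0).eval (n : ℤ)).toNat 1 with hN
  refine ⟨a.natAbs + b.natAbs + 1, by omega, fun x hx => ?_⟩
  set E : ℕ := a.natAbs + b.natAbs + 1 with hE
  have hNpos : ∀ n, 0 < N n := fun n => lt_of_lt_of_le one_pos (le_max_right _ _)
  have hNle : ∀ n, n ≤ x → N n ≤ E * (x + 1) := by
    intro n hn
    refine max_le ?_ (Nat.one_le_iff_ne_zero.mpr (by positivity))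
    rw [Int.toNat_le, hev, hE]
    push_cast
    have hn' : (n : ℤ) ≤ x := by exact_mod_cast hn
    have hx0 : (0 : ℤ) ≤ x := by positivity
    have h1 : a * n ≤ |a| * x :=
      (mul_le_mul_of_nonneg_right (le_abs_self a) (by positivity)).trans
        (mul_le_mul_of_nonneg_left hn' (abs_nonneg a))
    nlinarith [le_abs_self b, abs_nonneg a, abs_nonneg b]
  -- values with `N n ≥ 2` are genuine: `f₀(n) = N n`
  have hval : ∀ n, 2 ≤ N n → (f 0).eval (n : ℤ) = (N n : ℤ) := by
    intro n hn
    have hT : 2 ≤ ((f 0).eval (n : ℤ)).toNat := by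
      rcases le_max_iff.mp hn with h | h
      · exact h
      · exact absurd h (by norm_num)
    have h0 : (0 : ℤ) ≤ (f 0).eval (n : ℤ) := by
      have := Int.lt_toNat.mp (lt_of_lt_of_le (by norm_num : 0 < 2) hT)
      exact_mod_cast this.le
    show (f 0).eval (n : ℤ) = ((max ((f 0).eval (n : ℤ)).toNat 1 : ℕ) : ℤ)
    rw [max_eq_left (le_trans (by norm_num) hT), Int.toNat_of_nonneg h0]
  -- the index set of `K_x` as a sigma-finset, and the comparison map
  set S := (range (x + 1)).sigma fun n => (tuples f n).filter fun d => x < ∏ i, d i with hS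
  have hmem : ∀ (n : ℕ) (d : Fin 1 → ℕ), (⟨n, d⟩ : Σ _ : ℕ, Fin 1 → ℕ) ∈ S →
      n ≤ x ∧ d 0 ∣ N n ∧ x < d 0 := by
    intro n d hq
    rw [Finset.mem_sigma, Finset.mem_range, Finset.mem_filter, tuples, Fintype.mem_piFinset,
      Fin.prod_univ_one] at hq
    obtain ⟨hn, hd, hxd⟩ := hq
    have h0 := hd 0
    rw [divSet, Nat.mem_divisors] at h0
    exact ⟨Nat.lt_succ_iff.mp hn, h0.1, hxd⟩
  let φ : (Σ _ : ℕ, Fin 1 → ℕ) → ℕ × ℕ := fun q => (N q.1 / q.2 0, q.2 0)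
  have hinj : Set.InjOn φ S := by
    rintro ⟨n, d⟩ hq ⟨n', d'⟩ hq' heq
    obtain ⟨-, hdvd, hxd⟩ := hmem n d hq
    obtain ⟨-, hdvd', -⟩ := hmem n' d' hq'
    simp only [φ, Prod.mk.injEq] at heq
    obtain ⟨hquot, ht⟩ := heq
    have hNN : N n = N n' := by
      rw [← Nat.div_mul_cancel hdvd, ← Nat.div_mul_cancel hdvd', hquot, ht]
    have h2 : 2 ≤ N n := le_trans (by omega) (Nat.le_of_dvd (hNpos n) hdvd)
    have h2' : 2 ≤ N n' := hNN ▸ h2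
    have hnn : n = n' := by
      have h := hval n h2
      rw [hNN, ← hval n' h2', hev, hev] at h
      have h' : a * (n : ℤ) = a * (n' : ℤ) := by linarith
      exact_mod_cast mul_left_cancel₀ ha h'
    subst hnn
    have hdd : d = d' := by
      funext i
      rw [Fin.eq_zero i]
      exact ht
    subst hdd
    rfl
  have hmaps : ∀ q ∈ S, φ q ∈ Icc 1 E ×ˢ Icc 1 (E * (x + 1)) := by
    rintro ⟨n, d⟩ hq
    obtain ⟨hn, hdvd, hxd⟩ := hmem n d hq
    have hd0 : 0 < d 0 := by omega
    have hdle : d 0 ≤ N n := Nat.le_of_dvd (hNpos n) hdvd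
    have hNE := hNle n hn
    simp only [φ, Finset.mem_product, Finset.mem_Icc]
    refine ⟨⟨Nat.div_pos hdle hd0, Nat.div_le_of_le_mul ?_⟩, hd0, hdle.trans hNE⟩
    calc N n ≤ E * (x + 1) := hNE
      _ ≤ E * d 0 := Nat.mul_le_mul_left E hxd
      _ = d 0 * E := mul_comm _ _
  unfold kernelSum
  rw [Finset.sum_sigma']
  calc ∑ q ∈ S, ∏ i, thinWeight y (q.2 i) = ∑ q ∈ S, thinWeight y (φ q).2 :=
        Finset.sum_congr rfl fun q _ => Fin.prod_univ_one _
    _ = ∑ r ∈ S.image φ, thinWeight y r.2 := (Finset.sum_image (f := fun r : ℕ × ℕ => thinWeight y r.2) hinj).symm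
    _ ≤ ∑ r ∈ Icc 1 E ×ˢ Icc 1 (E * (x + 1)), thinWeight y r.2 :=
        Finset.sum_le_sum_of_subset_of_nonneg (Finset.image_subset_iff.mpr hmaps)
          fun r _ _ => thinWeight_nonneg hy _
    _ = (E : ℝ) * ∑ m ∈ Icc 1 (E * (x + 1)), thinWeight y m := by
        rw [Finset.sum_product]
        dsimp only
        rw [Finset.sum_const, Nat.card_Icc, nsmul_eq_mul, Nat.add_sub_cancel]

/-- `K_x(y) ≥ 0` for `y ≥ 1`. [folklore] -/
theorem kernelSum_nonneg {k : ℕ} (f : Fin k → ℤ[X]) {y : ℝ} (hy : 1 ≤ y) (x : ℕ) : 0 ≤ kernelSum f y x :=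
  Finset.sum_nonneg fun _ _ => Finset.sum_nonneg fun d _ => prod_thinWeight_nonneg hy d

/-! ### The kernel law for linear systems -/

/-- **The kernel law for LINEAR Bateman–Horn systems** (registered calibration of the open stub
`stub_betaKernel`): for `f : Fin 1 → ℤ[X]` a Bateman–Horn system with `deg f₀ = 1` and every real `y > 1`,
`BetaKernelLaw 1 f y` holds — here `D = 1`, the forced constant `λ_f(y)(D^{y−1}Γ(y)^{−1} − Γ(y)^{−1})` is `0`,
and indeed `x⁻¹(log x)^{1−y} K_x(y) ≪ (log x)^{−1} → 0` by `kernelSum_le_of_natDegree_eq_one` and the mean value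
`sum_thinWeight_le`. [folklore] -/
theorem betaKernelLaw_of_natDegree_eq_one : ∀ (f : Fin 1 → ℤ[X]), IsBatemanHornSystem f →
    (f 0).natDegree = 1 → ∀ y : ℝ, 1 < y → BetaKernelLaw 1 f y := by
  intro f _ hdeg y hy
  obtain ⟨C, hC0, hC⟩ := sum_thinWeight_le hy
  obtain ⟨E, hE1, hE⟩ := kernelSum_le_of_natDegree_eq_one f hdeg hy.le
  unfold BetaKernelLaw
  have hconst : eulerFactor f y *
      (Complex.exp (((y : ℂ) - 1) * (Real.log (∏ i, ((f i).natDegree : ℝ)) : ℂ)) * (Complex.Gamma y)⁻¹ ^ (1 : ℕ) -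
        (Complex.Gamma (((1 : ℕ) : ℂ) * ((y : ℂ) - 1) + 1))⁻¹) = 0 := by
    simp [hdeg]
  rw [hconst, tendsto_zero_iff_norm_tendsto_zero]
  -- the real form of the normalised kernel
  have hreal : ∀ x : ℕ, ‖(x : ℂ)⁻¹ * Complex.exp (((1 : ℕ) : ℂ) * (1 - (y : ℂ)) * (Real.log (Real.log x) : ℂ)) *
      (kernelSum f y x : ℂ)‖ = (x : ℝ)⁻¹ * Real.exp ((1 - y) * Real.log (Real.log x)) * kernelSum f y x := by
    intro x
    have h : (x : ℂ)⁻¹ * Complex.exp (((1 : ℕ) : ℂ) * (1 - (y : ℂ)) * (Real.log (Real.log x) : ℂ)) *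
        (kernelSum f y x : ℂ) =
        (((x : ℝ)⁻¹ * Real.exp ((1 - y) * Real.log (Real.log x)) * kernelSum f y x : ℝ) : ℂ) := by
      push_cast
      ring_nf
    rw [h, Complex.norm_real, Real.norm_of_nonneg]
    have := kernelSum_nonneg f hy.le x
    positivity
  simp_rw [hreal]
  -- the comparison sequence `K / log x → 0`
  set K : ℝ := 2 * E * E * C * Real.exp ((y - 1) * Real.log 2) with hK
  have hlim : Tendsto (fun x : ℕ => K * (Real.log x)⁻¹) atTop (𝓝 0) := by
    have h := (Real.tendsto_log_atTop.comp tendsto_natCast_atTop_atTop).inv_tendsto_atTop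
    simpa using h.const_mul K
  refine squeeze_zero' (Eventually.of_forall fun x => ?_) ?_ hlim
  · have := kernelSum_nonneg f hy.le x
    positivity
  filter_upwards [eventually_ge_atTop 2, eventually_ge_atTop (2 * E)] with x hx2 hxE
  have hx2' : (2 : ℝ) ≤ x := by exact_mod_cast hx2
  have hx0 : (0 : ℝ) < x := by linarith
  have hL : 0 < Real.log x := Real.log_pos (by linarith)
  -- the height `X = E (x + 1)`: `x < X ≤ x²`
  have hX2 : 2 ≤ E * (x + 1) := le_trans hx2 (by nlinarith)
  have hS := hC (E * (x + 1)) hX2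
  have hKx := hE x (by omega)
  push_cast at hS
  set X : ℝ := (E : ℝ) * (x + 1) with hXdef
  have hE1' : (1 : ℝ) ≤ E := by exact_mod_cast hE1
  have hxX : (x : ℝ) ≤ X := by rw [hXdef]; nlinarith
  have hXx2 : X ≤ (x : ℝ) ^ 2 := by
    have : (2 : ℝ) * E ≤ x := by exact_mod_cast hxE
    rw [hXdef]; nlinarith
  have hX0 : 0 < X := by linarith
  have hlogX : Real.log x ≤ Real.log X := Real.log_le_log hx0 hxX
  have hlogX2 : Real.log X ≤ 2 * Real.log x := by
    calc Real.log X ≤ Real.log ((x : ℝ) ^ 2) := Real.log_le_log hX0 hXx2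
      _ = 2 * Real.log x := by rw [Real.log_pow]; push_cast; ring
  have hllX : Real.log (Real.log X) ≤ Real.log 2 + Real.log (Real.log x) := by
    rw [← Real.log_mul (by norm_num) hL.ne']
    exact Real.log_le_log (by linarith) hlogX2
  have hy0 : 0 ≤ y - 1 := by linarith
  -- Step 1: the mean value at height `X`, weakened to the scale `x`
  have hS' : ∑ m ∈ Icc 1 (E * (x + 1)), thinWeight y m ≤
      C * (X / Real.log x) * Real.exp ((y - 1) * (Real.log 2 + Real.log (Real.log x))) := by
    refine hS.trans ?_
    gcongr
  -- Step 2: assemble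
  have hexp : Real.exp ((1 - y) * Real.log (Real.log x)) *
      Real.exp ((y - 1) * (Real.log 2 + Real.log (Real.log x))) = Real.exp ((y - 1) * Real.log 2) := by
    rw [← Real.exp_add]; ring_nf
  have hratio : X * (x : ℝ)⁻¹ ≤ 2 * E := by
    rw [hXdef, mul_assoc, mul_comm (2 : ℝ)]
    refine mul_le_mul_of_nonneg_left ?_ (by positivity)
    rw [← div_eq_mul_inv, div_le_iff₀ hx0]
    linarith
  calc (x : ℝ)⁻¹ * Real.exp ((1 - y) * Real.log (Real.log x)) * kernelSum f y x
      ≤ (x : ℝ)⁻¹ * Real.exp ((1 - y) * Real.log (Real.log x)) *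
          ((E : ℝ) * (C * (X / Real.log x) * Real.exp ((y - 1) * (Real.log 2 + Real.log (Real.log x))))) := by
        gcongr
        exact hKx.trans (mul_le_mul_of_nonneg_left hS' (by positivity))
    _ = E * C * Real.exp ((y - 1) * Real.log 2) * (X * (x : ℝ)⁻¹) * (Real.log x)⁻¹ := by
        rw [← hexp]; field_simp
    _ ≤ E * C * Real.exp ((y - 1) * Real.log 2) * (2 * E) * (Real.log x)⁻¹ := by gcongr
    _ = K * (Real.log x)⁻¹ := by rw [hK]; ring

end

end Summit.Parity.BatemanHorn.Cruxes.SystemLSDRealSegment.BetaThinnedRootKernel
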